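import Summits.CriticalPhenomena.PercolationContinuityZ3.Theorems.PercNearOneGluingNoHeavyLowerTailThreePointVarianceCutVertex
import HarnessLib

/-!
# The three-point determinant `P(abc)·P(a|b|c) − P(ac|b)·P(bc|a)` vanishes when `c` separates `a` from `b`

Support file for crux `stmt-CriticalPhenomena-4575` (`NoHeavyLowerTail`), seat `prim-l12-p1` gen 21 (`--supports stmt-CriticalPhenomena-4575`);
a corollary file of gen 16's `…ThreePointVarianceCutVertex` (same separator setting, same null-event/independence lemmas).
Memo `run/shared/lean/prim/prim-l12/FROM-prim-l12-p1-g21-SEXTIC-ISOLATION-LAW.md` §8.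

Gladkov's Conjecture 10.1 (arXiv:2408.08457, §10; = Gladkov–Zimin 2024, Conj. 6.3; open in print, its two-small-cells weakening is the
proved Thm. 1.3, tree `gladkov2024_thm_1_3_holds`) reads `P(ab|c) < δ ⟹ P(abc)·P(a|b|c) − P(ac|b)·P(bc|a) < ε`.  Here its EQUALITY LOCUS:
on every finite weighted graph in which `c` separates `a` from `b` (a vertex set `S ∋ a` with `b, c ∉ S` and all pairs between `S` and
`V ∖ (S ∪ {c})` of weight `0`), `P(ab|c) = 0` and `P(abc)·P(a|b|c) = P(ac|b)·P(bc|a)` exactly — off a null event the two sides of the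
cut are independent and `{a↔b} = {a↔c} ∩ {b↔c}`, so the cells are `αβ, 0, α(1−β), β(1−α), (1−α)(1−β)`.
Main results: `real_ab_not_ac_eq_zero_of_cutVertex`, `threePointDeterminant_cutVertex` [this work].
-/

namespace Summit.CriticalPhenomena.PercolationContinuityZ3.Theorems.ThreePointVarianceCutVertex

open MeasureTheory Set
open Literature.Probability.Percolation Literature.Probability.LatticeModels

variable {V : Type*} [Fintype V] [DecidableEq V]

/-! ## The two identities -/

/-- **`P(ab|c) = 0` when `c` separates `a` from `b`.** [this work] -/
theorem real_ab_not_ac_eq_zero_of_cutVertex (w : Sym2 V → unitInterval) {a b c : V} (S : Finset V) (ha : a ∈ S) (hb : b ∉ S)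
    (hw : ∀ u ∈ S, ∀ v, v ∉ S → v ≠ c → (w s(u, v) : ℝ) = 0) :
    (prodBernoulli w).real (openConn a b ∩ (openConn a c)ᶜ) = 0 := by
  have hN : (prodBernoulli w).real (bad S c) = 0 := real_bad w S c hw
  have hsub : openConn a b ∩ (openConn a c)ᶜ ⊆ bad S c := by
    rintro ω ⟨h, hac⟩
    by_contra hn
    exact hac ((openConn_ab_iff ha hb hn).1 h).1
  exact le_antisymm ((measureReal_mono hsub).trans hN.le) measureReal_nonneg

/-- **The three-point determinant vanishes on separator graphs**: if `a ∈ S`, `b, c ∉ S` and every pair between `S` and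
`V ∖ (S ∪ {c})` has weight `0`, then `P(abc)·P(a|b|c) = P(ac|b)·P(bc|a)`, i.e.
`P(a↔b, a↔c)·P(a↮b, a↮c, b↮c) = P(a↔c, a↮b)·P(b↔c, a↮b)` — the equality case of Gladkov's Conj. 10.1 / GZ24 Conj. 6.3. [this work] -/
theorem threePointDeterminant_cutVertex (w : Sym2 V → unitInterval) {a b c : V} (S : Finset V) (ha : a ∈ S) (hb : b ∉ S) (hc : c ∉ S)
    (hw : ∀ u ∈ S, ∀ v, v ∉ S → v ≠ c → (w s(u, v) : ℝ) = 0) :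
    (prodBernoulli w).real (openConn a b ∩ openConn a c) *
        (prodBernoulli w).real ((openConn a b)ᶜ ∩ (openConn a c)ᶜ ∩ (openConn b c)ᶜ) =
      (prodBernoulli w).real (openConn a c ∩ (openConn a b)ᶜ) * (prodBernoulli w).real (openConn b c ∩ (openConn a b)ᶜ) := by
  have hN : (prodBernoulli w).real (bad S c) = 0 := real_bad w S c hw
  set RA := reachIn (insert c S) a c with hRA
  set RB := reachIn (Finset.univ.filter fun x => x ∉ S) b c with hRB
  have hdetA : DeterminedBy RA (↑(pairsIn (insert c S)) : Set (Sym2 V)) := determinedBy_reachIn _ a c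
  have hdetB : DeterminedBy RB (↑(pairsIn (Finset.univ.filter fun x => x ∉ S)) : Set (Sym2 V)) := determinedBy_reachIn _ b c
  have hdisj := disjoint_pairsIn S c hc
  have hind : ∀ {X Y : Set (BondConfig V)}, DeterminedBy X (↑(pairsIn (insert c S)) : Set (Sym2 V)) →
      DeterminedBy Y (↑(pairsIn (Finset.univ.filter fun x => x ∉ S)) : Set (Sym2 V)) →
      (prodBernoulli w).real (X ∩ Y) = (prodBernoulli w).real X * (prodBernoulli w).real Y :=
    fun hX hY => prodBernoulli_real_inter_of_determinedBy_disjoint w hdisj hX hY MeasurableSet.of_discrete MeasurableSet.of_discrete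
  have hAc : (prodBernoulli w).real RAᶜ = 1 - (prodBernoulli w).real RA := probReal_compl_eq_one_sub MeasurableSet.of_discrete
  have hBc : (prodBernoulli w).real RBᶜ = 1 - (prodBernoulli w).real RB := probReal_compl_eq_one_sub MeasurableSet.of_discrete
  -- the four cells off the null event
  have ex : (openConn a b ∩ openConn a c) ∩ (bad S c)ᶜ = (RA ∩ RB) ∩ (bad S c)ᶜ := by
    ext ω; simp only [mem_inter_iff, mem_compl_iff]
    constructor
    · rintro ⟨⟨h, -⟩, hn⟩
      obtain ⟨h1, h2⟩ := (openConn_ab_iff ha hb hn).1 h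
      exact ⟨⟨(openConn_ac_iff ha hc hn).1 h1, (openConn_bc_iff hb hn).1 h2⟩, hn⟩
    · rintro ⟨⟨h1, h2⟩, hn⟩
      have h1' := (openConn_ac_iff ha hc hn).2 h1
      exact ⟨⟨(openConn_ab_iff ha hb hn).2 ⟨h1', (openConn_bc_iff hb hn).2 h2⟩, h1'⟩, hn⟩
  have et : (openConn a c ∩ (openConn a b)ᶜ) ∩ (bad S c)ᶜ = (RA ∩ RBᶜ) ∩ (bad S c)ᶜ := by
    ext ω; simp only [mem_inter_iff, mem_compl_iff]
    constructor
    · rintro ⟨⟨h1, h2⟩, hn⟩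
      refine ⟨⟨(openConn_ac_iff ha hc hn).1 h1, fun h => h2 ?_⟩, hn⟩
      exact (openConn_ab_iff ha hb hn).2 ⟨h1, (openConn_bc_iff hb hn).2 h⟩
    · rintro ⟨⟨h1, h2⟩, hn⟩
      refine ⟨⟨(openConn_ac_iff ha hc hn).2 h1, fun h => h2 ?_⟩, hn⟩
      exact (openConn_bc_iff hb hn).1 ((openConn_ab_iff ha hb hn).1 h).2
  have eu : (openConn b c ∩ (openConn a b)ᶜ) ∩ (bad S c)ᶜ = (RAᶜ ∩ RB) ∩ (bad S c)ᶜ := by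
    ext ω; simp only [mem_inter_iff, mem_compl_iff]
    constructor
    · rintro ⟨⟨h1, h2⟩, hn⟩
      refine ⟨⟨fun h => h2 ?_, (openConn_bc_iff hb hn).1 h1⟩, hn⟩
      exact (openConn_ab_iff ha hb hn).2 ⟨(openConn_ac_iff ha hc hn).2 h, h1⟩
    · rintro ⟨⟨h1, h2⟩, hn⟩
      refine ⟨⟨(openConn_bc_iff hb hn).2 h2, fun h => h1 ?_⟩, hn⟩
      exact (openConn_ac_iff ha hc hn).1 ((openConn_ab_iff ha hb hn).1 h).1
  have eq : ((openConn a b)ᶜ ∩ (openConn a c)ᶜ ∩ (openConn b c)ᶜ) ∩ (bad S c)ᶜ = (RAᶜ ∩ RBᶜ) ∩ (bad S c)ᶜ := by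
    ext ω; simp only [mem_inter_iff, mem_compl_iff]
    constructor
    · rintro ⟨⟨⟨-, h2⟩, h3⟩, hn⟩
      exact ⟨⟨fun h => h2 ((openConn_ac_iff ha hc hn).2 h), fun h => h3 ((openConn_bc_iff hb hn).2 h)⟩, hn⟩
    · rintro ⟨⟨h1, h2⟩, hn⟩
      refine ⟨⟨⟨fun h => h1 ?_, fun h => h1 ((openConn_ac_iff ha hc hn).1 h)⟩, fun h => h2 ((openConn_bc_iff hb hn).1 h)⟩, hn⟩
      exact (openConn_ac_iff ha hc hn).1 ((openConn_ab_iff ha hb hn).1 h).1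
  -- probabilities
  have px : (prodBernoulli w).real (openConn a b ∩ openConn a c) = (prodBernoulli w).real RA * (prodBernoulli w).real RB := by
    rw [← real_inter_compl_of_null w hN (openConn a b ∩ openConn a c), ex, real_inter_compl_of_null w hN, hind hdetA hdetB]
  have pt : (prodBernoulli w).real (openConn a c ∩ (openConn a b)ᶜ) = (prodBernoulli w).real RA * (1 - (prodBernoulli w).real RB) := by
    rw [← real_inter_compl_of_null w hN (openConn a c ∩ (openConn a b)ᶜ), et, real_inter_compl_of_null w hN,
      hind hdetA (OneLayerTwoFinger.determinedBy_compl hdetB), hBc]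
  have pu : (prodBernoulli w).real (openConn b c ∩ (openConn a b)ᶜ) = (1 - (prodBernoulli w).real RA) * (prodBernoulli w).real RB := by
    rw [← real_inter_compl_of_null w hN (openConn b c ∩ (openConn a b)ᶜ), eu, real_inter_compl_of_null w hN,
      hind (OneLayerTwoFinger.determinedBy_compl hdetA) hdetB, hAc]
  have pq : (prodBernoulli w).real ((openConn a b)ᶜ ∩ (openConn a c)ᶜ ∩ (openConn b c)ᶜ) =
      (1 - (prodBernoulli w).real RA) * (1 - (prodBernoulli w).real RB) := by
    rw [← real_inter_compl_of_null w hN ((openConn a b)ᶜ ∩ (openConn a c)ᶜ ∩ (openConn b c)ᶜ), eq, real_inter_compl_of_null w hN,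
      hind (OneLayerTwoFinger.determinedBy_compl hdetA) (OneLayerTwoFinger.determinedBy_compl hdetB), hAc, hBc]
  rw [px, pt, pu, pq]; ring


end Summit.CriticalPhenomena.PercolationContinuityZ3.Theorems.ThreePointVarianceCutVertex
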